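import Summits.KontsevichZagierPeriods.KontsevichZagierPeriods.Theorems.LinRedNormalFormArrangementNormalFormSeparateHighFanSub
import Summits.KontsevichZagierPeriods.KontsevichZagierPeriods.Theorems.LinRedNormalFormArrangementNormalFormSeparateHighFan

/-!
# `stub_separateHigh` for numerators bounded away from zero, without any flats hypothesis

(Line `janus-bands`, crux `ArrangementNormalForm`, stubs `stub_separateHigh` /
`stub_separateThreeZero` — separation in base dimension `≥ 3`; part `FanPos` (registered as
`separateHigh_fanPos`), valid in every base dimension `B + 2 ≥ 2`.)

**Theorem** (`separateHigh_fanPos`). A Janus band representation `s` over the base `ℝ^{B+2}`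
with `k` fibres (literal `JJ (B+2) k` data on a bounded rational cell) whose numerator `P` is
bounded away from zero on the domain, `|P| ≥ c₀ > 0`, is congruent modulo `KZ.relations` to a
`ℤ`-combination of elements of `GG (B+1) 1 k`.

This supersedes `separateHigh_of_flatsDisjoint` (no hypothesis on the codimension-2 flats of the
letters any more). Proof: the fan lemma with sub-cells `separateHigh_fan_sub` yields the fan
certificate of `[s]` whose pieces are sub-cells `s₁.domain ⊆ s.domain`, so the lower bound on
`P` restricts to every piece and the certificate upgrades to the FAN⁺ certificate of
`separateHigh_of_fan` (`SepHigh.fanPos_of_fanSub`), which concludes.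
-/

noncomputable section

open Set MeasureTheory MvPolynomial

namespace Summit.KontsevichZagierPeriods.ArrangementNormalForm.JanusBands

open Literature.NumberTheory.Transcendental

namespace SepHigh

open SeparatePos

/-- FAN certificate with sub-cells + numerator bounded away from zero on the parent cell ⟹ FAN⁺
certificate (the generators embed, piece by piece). [folklore] -/
theorem fanPos_of_fanSub {B k m : ℕ} (L : Fin m → (Fin (B + 2) → ℚ) × ℚ) (e : Fin m → ℕ)
    (p : MvPolynomial (Fin (B + 2)) ℚ) (a : Fin k → Option ((Fin (B + 2) → ℚ) × ℚ))
    (lo hi : Fin k → Fin k ⊕ ((Fin (B + 2) → ℚ) × ℚ)) (D : Set (Fin (B + 2 + k) → ℝ))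
    (hnum : ∃ c₀ : ℝ, 0 < c₀ ∧ ∀ z ∈ D, c₀ ≤ |MvPolynomial.aeval (fun i => z (Fin.castAdd k i)) p|) :
    {w : KZ.FormalRep | ∃ (m₁ : ℕ) (M₁ : Fin m₁ → (Fin (B + 2) → ℚ) × ℚ)
      (s₁ : KZ.IntegralRep (B + 2 + k)) (v : Fin (B + 2) → ℚ), v (Fin.last (B + 1)) ≠ 0 ∧
      Bornology.IsBounded s₁.domain ∧
      s₁.domain = {z | (∀ j, 0 < ∑ i, ((M₁ j).1 i : ℝ) * z (Fin.castAdd k i) + ((M₁ j).2 : ℝ)) ∧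
        ∀ i, Sum.elim (fun j => z (Fin.natAdd (B + 2) j)) (fun c => ∑ i', (c.1 i' : ℝ) *
          z (Fin.castAdd k i') + (c.2 : ℝ)) (lo i) < z (Fin.natAdd (B + 2) i) ∧
          z (Fin.natAdd (B + 2) i) < Sum.elim (fun j => z (Fin.natAdd (B + 2) j))
          (fun c => ∑ i', (c.1 i' : ℝ) * z (Fin.castAdd k i') + (c.2 : ℝ)) (hi i)} ∧
      EqOn s₁.integrand (fun z => MvPolynomial.aeval (fun i => z (Fin.castAdd k i)) p /
        (∏ j, (∑ i, ((L j).1 i : ℝ) * z (Fin.castAdd k i) + ((L j).2 : ℝ)) ^ e j) *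
        ∏ i, (a i).elim 1 (fun c => 1 / (z (Fin.natAdd (B + 2) i) -
          (∑ i', (c.1 i' : ℝ) * z (Fin.castAdd k i') + (c.2 : ℝ))))) s₁.domain ∧
      s₁.domain ⊆ D ∧
      (∀ j, (∑ i, (L j).1 i * v i) ≠ 0 → e j ≠ 0 → ∀ z ∈ s₁.domain,
        ∑ i, ((L j).1 i : ℝ) * z (Fin.castAdd k i) + ((L j).2 : ℝ) ≠ 0) ∧
      (∀ j j', (∑ i, (L j).1 i * v i) ≠ 0 → (∑ i, (L j').1 i * v i) ≠ 0 → e j ≠ 0 → e j' ≠ 0 →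
        (∑ i, (L j').1 i * v i) • L j ≠ (∑ i, (L j).1 i * v i) • L j' →
        ∃ C : ℝ, ∀ z ∈ s₁.domain, |∑ i, ((L j').1 i : ℝ) * z (Fin.castAdd k i) + ((L j').2 : ℝ)| ≤
          C * |(((∑ i, (L j).1 i * v i) : ℚ) : ℝ) * (∑ i, ((L j').1 i : ℝ) * z (Fin.castAdd k i) +
            ((L j').2 : ℝ)) - (((∑ i, (L j').1 i * v i) : ℚ) : ℝ) *
            (∑ i, ((L j).1 i : ℝ) * z (Fin.castAdd k i) + ((L j).2 : ℝ))|) ∧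
      w = KZ.of s₁} ⊆
    {w : KZ.FormalRep | ∃ (m₁ : ℕ) (M₁ : Fin m₁ → (Fin (B + 2) → ℚ) × ℚ)
      (s₁ : KZ.IntegralRep (B + 2 + k)) (v : Fin (B + 2) → ℚ), v (Fin.last (B + 1)) ≠ 0 ∧
      Bornology.IsBounded s₁.domain ∧
      s₁.domain = {z | (∀ j, 0 < ∑ i, ((M₁ j).1 i : ℝ) * z (Fin.castAdd k i) + ((M₁ j).2 : ℝ)) ∧
        ∀ i, Sum.elim (fun j => z (Fin.natAdd (B + 2) j)) (fun c => ∑ i', (c.1 i' : ℝ) *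
          z (Fin.castAdd k i') + (c.2 : ℝ)) (lo i) < z (Fin.natAdd (B + 2) i) ∧
          z (Fin.natAdd (B + 2) i) < Sum.elim (fun j => z (Fin.natAdd (B + 2) j))
          (fun c => ∑ i', (c.1 i' : ℝ) * z (Fin.castAdd k i') + (c.2 : ℝ)) (hi i)} ∧
      EqOn s₁.integrand (fun z => MvPolynomial.aeval (fun i => z (Fin.castAdd k i)) p /
        (∏ j, (∑ i, ((L j).1 i : ℝ) * z (Fin.castAdd k i) + ((L j).2 : ℝ)) ^ e j) *
        ∏ i, (a i).elim 1 (fun c => 1 / (z (Fin.natAdd (B + 2) i) -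
          (∑ i', (c.1 i' : ℝ) * z (Fin.castAdd k i') + (c.2 : ℝ))))) s₁.domain ∧
      (∃ c₀ : ℝ, 0 < c₀ ∧ ∀ z ∈ s₁.domain, c₀ ≤ |MvPolynomial.aeval (fun i => z (Fin.castAdd k i)) p|) ∧
      (∀ j, (∑ i, (L j).1 i * v i) ≠ 0 → e j ≠ 0 → ∀ z ∈ s₁.domain,
        ∑ i, ((L j).1 i : ℝ) * z (Fin.castAdd k i) + ((L j).2 : ℝ) ≠ 0) ∧
      (∀ j j', (∑ i, (L j).1 i * v i) ≠ 0 → (∑ i, (L j').1 i * v i) ≠ 0 → e j ≠ 0 → e j' ≠ 0 →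
        (∑ i, (L j').1 i * v i) • L j ≠ (∑ i, (L j).1 i * v i) • L j' →
        ∃ C : ℝ, ∀ z ∈ s₁.domain, |∑ i, ((L j').1 i : ℝ) * z (Fin.castAdd k i) + ((L j').2 : ℝ)| ≤
          C * |(((∑ i, (L j).1 i * v i) : ℚ) : ℝ) * (∑ i, ((L j').1 i : ℝ) * z (Fin.castAdd k i) +
            ((L j').2 : ℝ)) - (((∑ i, (L j').1 i * v i) : ℚ) : ℝ) *
            (∑ i, ((L j).1 i : ℝ) * z (Fin.castAdd k i) + ((L j).2 : ℝ))|) ∧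
      w = KZ.of s₁} := by
  obtain ⟨c₀, hc₀, hnum⟩ := hnum
  rintro w ⟨m₁, M₁, s₁, v, hv, hbd₁, hdom₁, hint₁, hsub, hpole, hrat, hw⟩
  exact ⟨m₁, M₁, s₁, v, hv, hbd₁, hdom₁, hint₁, ⟨c₀, hc₀, fun z hz => hnum z (hsub hz)⟩, hpole,
    hrat, hw⟩

end SepHigh

open SeparatePos SepHigh in
/-- **`stub_separateHigh` for numerators bounded away from zero** (registered part
`separateHigh_fanPos` of `stub_separateHigh`; every base dimension `B + 2 ≥ 2`, no hypothesis on
the flats of the letters): a Janus band representation over `ℝ^{B+2}` with `k` fibres whose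
numerator satisfies `|P| ≥ c₀ > 0` on the domain is congruent modulo `KZ.relations` to a
`ℤ`-combination of elements of `GG (B+1) 1 k`; see the module docstring.
[Kontsevich–Zagier 2001, §1.2] -/
theorem separateHigh_fanPos (GG : ℕ → ℕ → ℕ → Set KZ.FormalRep) (hGG : ∀ b σ k, GG b σ k = {w : KZ.FormalRep | ∃ (m m' n₁ n₂ : ℕ) (s : KZ.IntegralRep (b + 1 + k)) (M : Fin m' → (Fin (b + 1) → ℚ) × ℚ) (L : Fin m → (Fin b → ℚ) × ℚ) (e : Fin m → ℕ) (p : MvPolynomial (Fin b) ℚ) (ℓ₁ ℓ₂ : (Fin b → ℚ) × ℚ) (a : Fin k → Option ((Fin (b + 1) → ℚ) × ℚ)) (lo hi : Fin k → Fin k ⊕ ((Fin (b + 1) → ℚ) × ℚ)), (n₁ = 0 ∨ n₂ = 0) ∧ (σ = 2 → (∀ i c, a i = some c → c.1 (Fin.last b) = 0) ∧ (∀ i c, (lo i = Sum.inr c ∨ hi i = Sum.inr c) → (c.1 (Fin.last b) = 0 ∨ c = (Pi.single (Fin.last b) 1, 0)))) ∧ Bornology.IsBounded s.domain ∧ s.domain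 = {z | (∀ j, 0 < ∑ i, ((M j).1 i : ℝ) * z (Fin.castAdd k i) + ((M j).2 : ℝ)) ∧ ∀ i, Sum.elim (fun j => z (Fin.natAdd (b + 1) j)) (fun c => ∑ i', (c.1 i' : ℝ) * z (Fin.castAdd k i') + (c.2 : ℝ)) (lo i) < z (Fin.natAdd (b + 1) i) ∧ z (Fin.natAdd (b + 1) i) < Sum.elim (fun j => z (Fin.natAdd (b + 1) j)) (fun c => ∑ i', (c.1 i' : ℝ) * z (Fin.castAdd k i') + (c.2 : ℝ)) (hi i)} ∧ EqOn s.integrand (fun z => MvPolynomial.aeval (fun i => z (Fin.castAdd k (Fin.castSucc i))) p / (∏ j, (∑ i, ((L j).1 i : ℝ) * z (Fin.castAdd k (Fin.castSucc i)) + ((L j).2 : ℝ)) ^ e j) * ((z (Fin.castAdd k (Fin.last b)) - (∑ i, (ℓ₁.1 i : ℝ) * z (Fin.castAdd k (Fin.castSucc i)) + (ℓ₁.2 : ℝ))) ^ n₁ / (z (Fin.castAdd k (Fin.last b)) - (∑ i, (ℓ₂.1 i : ℝ) * z (Fin.castAdd k (Fin.castSucc i)) + (ℓ₂.2 : ℝ)))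 ^ n₂) * ∏ i, (a i).elim 1 (fun c => 1 / (z (Fin.natAdd (b + 1) i) - (∑ i', (c.1 i' : ℝ) * z (Fin.castAdd k i') + (c.2 : ℝ))))) s.domain ∧ w = KZ.of s}) (B k m m' : ℕ) (s : KZ.IntegralRep (B + 2 + k)) (M : Fin m' → (Fin (B + 2) → ℚ) × ℚ) (L : Fin m → (Fin (B + 2) → ℚ) × ℚ) (e : Fin m → ℕ) (p : MvPolynomial (Fin (B + 2)) ℚ) (a : Fin k → Option ((Fin (B + 2) → ℚ) × ℚ)) (lo hi : Fin k → Fin k ⊕ ((Fin (B + 2) → ℚ) × ℚ)) (hbd : Bornology.IsBounded s.domain) (hdom : s.domain = {z | (∀ j, 0 < ∑ i, ((M j).1 i : ℝ) * z (Fin.castAdd k i) + ((M j).2 : ℝ)) ∧ ∀ i, Sum.elim (fun j => z (Fin.natAdd (B + 2) j)) (fun c => ∑ i', (c.1 i' : ℝ) * z (Fin.castAdd k i') + (c.2 : ℝ)) (lo i) < z (Fin.natAdd (B + 2) i) ∧ z (Fin.natAdd (B + 2) i) < Sum.elim (fun j => z (Fin.natAdd (B + 2) j)) (fun c => ∑ i',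 (c.1 i' : ℝ) * z (Fin.castAdd k i') + (c.2 : ℝ)) (hi i)}) (hint : EqOn s.integrand (fun z => MvPolynomial.aeval (fun i => z (Fin.castAdd k i)) p / (∏ j, (∑ i, ((L j).1 i : ℝ) * z (Fin.castAdd k i) + ((L j).2 : ℝ)) ^ e j) * ∏ i, (a i).elim 1 (fun c => 1 / (z (Fin.natAdd (B + 2) i) - (∑ i', (c.1 i' : ℝ) * z (Fin.castAdd k i') + (c.2 : ℝ))))) s.domain) (hnum : ∃ c₀ : ℝ, 0 < c₀ ∧ ∀ z ∈ s.domain, c₀ ≤ |MvPolynomial.aeval (fun i => z (Fin.castAdd k i)) p|) : ∃ c ∈ AddSubgroup.closure (GG (B + 1) 1 k), KZ.of s - c ∈ KZ.relations := by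
  obtain ⟨c, hc, hrel⟩ := separateHigh_fan_sub B k m m' s M L e p a lo hi hbd hdom hint
  exact separateHigh_of_fan GG hGG B k m L e p a lo hi (KZ.of s)
    ⟨c, AddSubgroup.closure_mono (fanPos_of_fanSub L e p a lo hi s.domain hnum) hc, hrel⟩

open SeparatePos SepHigh in
/-- The same, with the target written as `SeparatePos.GGset (B + 1) 1 k`. [Kontsevich–Zagier
2001, §1.2] -/
theorem separateHigh_fanPos_GGset (B k m m' : ℕ) (s : KZ.IntegralRep (B + 2 + k)) (M : Fin m' → (Fin (B + 2) → ℚ) × ℚ) (L : Fin m → (Fin (B + 2) → ℚ) × ℚ) (e : Fin m → ℕ) (p : MvPolynomial (Fin (B + 2)) ℚ) (a : Fin k → Option ((Fin (B + 2) → ℚ) × ℚ)) (lo hi : Fin k → Fin k ⊕ ((Fin (B + 2) → ℚ) × ℚ)) (hbd : Bornology.IsBounded s.domain) (hdom : s.domain = {z | (∀ j, 0 < ∑ i, ((M j).1 i : ℝ) * z (Fin.castAdd k i) + ((M j).2 : ℝ)) ∧ ∀ i, Sum.elim (fun j => z (Fin.natAdd (B + 2) j)) (fun c => ∑ i', (c.1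 i' : ℝ) * z (Fin.castAdd k i') + (c.2 : ℝ)) (lo i) < z (Fin.natAdd (B + 2) i) ∧ z (Fin.natAdd (B + 2) i) < Sum.elim (fun j => z (Fin.natAdd (B + 2) j)) (fun c => ∑ i', (c.1 i' : ℝ) * z (Fin.castAdd k i') + (c.2 : ℝ)) (hi i)}) (hint : EqOn s.integrand (fun z => MvPolynomial.aeval (fun i => z (Fin.castAdd k i)) p / (∏ j, (∑ i, ((L j).1 i : ℝ) * z (Fin.castAdd k i) + ((L j).2 : ℝ)) ^ e j) * ∏ i, (a i).elim 1 (fun c => 1 / (z (Fin.natAdd (B + 2) i) - (∑ i', (c.1 i' : ℝ) * z (Fin.castAdd k i') + (c.2 : ℝ))))) s.domain) (hnum : ∃ c₀ : ℝ, 0 < c₀ ∧ ∀ z ∈ s.domain, c₀ ≤ |MvPolynomial.aeval (fun i => z (Fin.castAdd k i)) p|) : ∃ c ∈ AddSubgroup.closure (SeparatePos.GGset (B + 1) 1 k), KZ.of s - c ∈ KZ.relations :=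
  separateHigh_fanPos GGset (fun _ _ _ => rfl) B k m m' s M L e p a lo hi hbd hdom hint hnum

end Summit.KontsevichZagierPeriods.ArrangementNormalForm.JanusBands
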